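import Summits.HodgeConjecture.HodgeCM.Model.ToyG2.Gysin3_1

/-! PORT of `HodgeCM/Model/ToyG2/Gysin3.lean` (HodgeCMPerL run 82) — part 2: continuation of `Summits.HodgeConjecture.HodgeCM.Model.ToyG2.Gysin3_1` (split at a top-level declaration boundary by port_pkg.py; scope re-opened below; declarations unchanged). -/

-- port_pkg: scope re-opened for this part (file-level context, then the namespace/section stack open at the cut)
noncomputable section
open scoped TensorProduct
open exteriorPower HodgeCM.Toy
open Literature.AlgebraicGeometry.Motives (CMType)
open Literature.AlgebraicGeometry.Motives.HodgeStructure (ofRat mem_hodgeClasses_iff)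
namespace HodgeCM.ToyG2
namespace BlockGysin
variable {D : HodgeData} {T : TraceSys} {pl : GBlocks}
local notation "U₃" => toyModel3With D T pl
section Exterior
variable (T pl)
local notation "UE" => toyModel3With exteriorHodgeData T pl
/-- degree transport does not change eigen-filtration membership -/
theorem theta_castCoh_mem_FF_iff (X : GObj) {k l : ℕ} (h : k = l) (q : ℤ) (z : (UE).Coh X k) :
    X.X.toObj.Θ l ((1 : ℂ) ⊗ₜ[ℚ] (UE).castCoh X h z) ∈ X.X.toObj.FF l q
      ↔ X.X.toObj.Θ k ((1 : ℂ) ⊗ₜ[ℚ] z) ∈ X.X.toObj.FF k q := by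
  subst h
  exact Iff.rfl

/-- membership in `alg^r` = membership of `Θ(1 ⊗ z)` in step `r` of the eigen-filtration of `⋀^{2r}` -/
theorem mem_alg_iff (X : GObj) (r : ℕ) (z : (UE).Coh X (2 * r)) :
    z ∈ (UE).alg X r ↔ X.X.toObj.Θ (2 * r) ((1 : ℂ) ⊗ₜ[ℚ] z) ∈ X.X.toObj.FF (2 * r) r :=
  (mem_hodgeClasses_iff _ _ _).trans X.X.toObj.mem_hodgeF

/-- `dim_ℂ F¹ = dim` for a block-free object -/
theorem finrank_F1_eq_dim {X : Obj₂} (h : X.IsBlockFree) : Module.finrank ℂ X.toObj.F1 = X.dim := by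
  have h1 := finrank_F1_eq_nhol X.toObj
  have h2 := X.toObj.two_mul_nhol_univ
  have h3 := Obj.card_Idx X.toObj
  have h4 := two_mul_dim_eq_finrank h
  change 2 * X.dim = Module.finrank ℚ X.toObj.L at h4
  omega

/-- **The Gysin map of a split block pair** (any good `P, Y, Y'` with `Y'` block-free and block restrictions
`ψ₁, ψ₂` of `H¹(P)`): the block contraction against `tr_{Y'}` satisfies both clauses of F7. -/
theorem gysin_core {P Y Y' : GObj} (pA : (UE).Mor P Y) (pB : (UE).Mor P Y') (hY' : Y'.X.IsBlockFree)
    (ψ₁ : P.X.L →ₗ[ℚ] Y.X.L) (ψ₂ : P.X.L →ₗ[ℚ] Y'.X.L) (h₁ : ψ₁ ∘ₗ pA.lin = LinearMap.id)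
    (h₂ : ψ₁ ∘ₗ pB.lin = 0) (h₃ : ψ₂ ∘ₗ pB.lin = LinearMap.id)
    (hψ₁ : Obj.IsHodge (X := Y.X.toObj) (Y := P.X.toObj) ψ₁)
    (hψ₂ : Obj.IsHodge (X := Y'.X.toObj) (Y := P.X.toObj) ψ₂) :
    ∃ gy : (k : ℕ) → ((UE).Coh P (k + 2 * Y'.X.dim) →ₗ[ℚ] (UE).Coh Y k),
      (∀ (p : ℕ) (z : (UE).Coh P (2 * (p + Y'.X.dim))), z ∈ (UE).alg P (p + Y'.X.dim) →
          gy (2 * p) ((UE).castCoh P (by omega) z) ∈ (UE).alg Y p) ∧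
      (∀ (k : ℕ) (e : (UE).Coh Y k) (ω : (UE).Coh Y' (2 * Y'.X.dim)),
          gy k ((UE).cup P k _ ((UE).pull pA k e) ((UE).pull pB _ ω)) = ((UE).tr _ _ ω) • e) := by
  refine ⟨fun k => contr k (2 * Y'.X.dim) ψ₁ ψ₂ (T.tr Y'.X (2 * Y'.X.dim)), fun p z hz => ?_, fun k e ω => ?_⟩
  · rw [mem_alg_iff]
    refine theta_contr_mem_FF ψ₁ ψ₂ hψ₁ hψ₂ (finrank_F1_eq_dim hY').le (T.tr Y'.X (2 * Y'.X.dim)) (p : ℤ) _ ?_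
    rw [theta_castCoh_mem_FF_iff]
    have ht := (mem_alg_iff T pl P _ z).mp hz
    push_cast at ht
    exact ht
  · exact contr_wedge_map (T.tr Y'.X (2 * Y'.X.dim)) pA.lin pB.lin h₁ h₂ h₃ e ω

/-- **F7 `Fact_gysin` in the exterior gen-3 universe**, for every trace system and every good block assignment. -/
theorem fact3_gysin : (UE).Fact_gysin := by
  intro F n m Ξ pA pB hP
  -- lattice form of the block-pair identities
  have hA : ∀ j, pA.lin ∘ₗ ((UE).prj n (fun j => (UE).cmAV F (Ξ (Fin.castAdd (m + 1) j))) j).lin =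
      ((UE).prj (n + 1 + m) (fun k => (UE).cmAV F (Ξ k)) (Fin.castAdd (m + 1) j)).lin :=
    fun j => lin_comp_eq_of_pull_one pA _ _ (hP.1 j 1)
  have hB : ∀ i, pB.lin ∘ₗ ((UE).prj m (fun i => (UE).cmAV F (Ξ (Fin.natAdd (n + 1) i))) i).lin =
      ((UE).prj (n + 1 + m) (fun k => (UE).cmAV F (Ξ k)) (Fin.natAdd (n + 1) i)).lin :=
    fun i => lin_comp_eq_of_pull_one pB _ _ (hP.2 i 1)
  -- the two block restrictions and their identities
  have h₁ := blockRes_comp_lin_self (D := exteriorHodgeData) (T := T) (pl := pl) (N := n + 1 + m) (n := n)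
    (fun k => (UE).cmAV F (Ξ k)) (Fin.castAdd (m + 1)) (Fin.castAdd_injective _ _) pA hA
  have h₂ := blockRes_comp_lin_of_disjoint (D := exteriorHodgeData) (T := T) (pl := pl) (N := n + 1 + m) (n := n)
    (m := m) (fun k => (UE).cmAV F (Ξ k)) (Fin.castAdd (m + 1)) (Fin.natAdd (n + 1))
    (fun j i => castAdd_ne_natAdd j i) pB hB
  have h₃ := blockRes_comp_lin_self (D := exteriorHodgeData) (T := T) (pl := pl) (N := n + 1 + m) (n := m)
    (fun k => (UE).cmAV F (Ξ k)) (Fin.natAdd (n + 1)) (Fin.natAdd_injective _ _) pB hB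
  have hH₁ := isHodge_blockRes (D := exteriorHodgeData) (T := T) (pl := pl) (N := n + 1 + m) (n := n)
    (fun k => (UE).cmAV F (Ξ k)) (Fin.castAdd (m + 1))
  have hH₂ := isHodge_blockRes (D := exteriorHodgeData) (T := T) (pl := pl) (N := n + 1 + m) (n := m)
    (fun k => (UE).cmAV F (Ξ k)) (Fin.natAdd (n + 1))
  exact gysin_core T pl pA pB (isBlockFree_cmProd F (blkB Ξ)) _ _ h₁ h₂ h₃ hH₁ hH₂

end Exterior

end BlockGysin

/-- **F7 holds in `toyUniverse₃`** (the universe of toy-g3's `GenericFacts3` / `TrTopAll3` joint witnesses). -/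
theorem toyUniverse₃_fact_gysin (d t : ℚ) : (toyUniverse₃ d t).Fact_gysin :=
  BlockGysin.fact3_gysin traceSys (gplOf d t)

end HodgeCM.ToyG2

end
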